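import Summits.QuantumFields.YangMills.Theorems.F4SubCurvatureDoorForwardConeLukacsOneDim
import Mathlib
import HarnessLib

/-!
# Rung R-S1ℓ `LukacsOneDim` (S1 programme / forward-cone rungs, crux ⟨stmt-QuantumFields-23125⟩) — BY NAME

Free-hands rung of width seat `ym-line-sfw-p2-w3` (g37, cell `ym-idea-1`) for OWNER `ym-idea-3` g21's rungs file
`Cruxes/RationalToGeneral/Lines/forward_cone_rungs.lean` (namespace `…Cruxes.RationalToGeneral.ForwardConeRungs`): the Prop `LukacsOneDim` is
restated CHARACTER-IDENTICALLY and proved as `lukacsOneDim_holds`, a one-line corollary of the def-free proof file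
`…ForwardConeLukacsOneDim.lean` (`exists_expMoment_of_analyticAt_cosTransform`: power series + symmetric differences + Fatou + Tonelli).

HONEST LABEL: a classical one-dimensional lemma ([Lukacs 1970, Thm 7.1.1], even part); S1, ⟨23125⟩, ⟨23035⟩ and R2d stay OPEN; the Yang–Mills
mass gap is NOT proved by this file.
-/

set_option autoImplicit false

noncomputable section

namespace Summit.QuantumFields.YangMills.Theorems.F4SubCurvatureDoorForwardConeLukacs

open MeasureTheory

/-- R-S1ℓ «LUKACS, ONE-DIMENSIONAL» — restated CHARACTER-IDENTICALLY from `Cruxes/RationalToGeneral/Lines/forward_cone_rungs.lean`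
(namespace `…Cruxes.RationalToGeneral.ForwardConeRungs`): a finite positive measure on `ℝ` whose cosine transform is real-analytic at `0` has an
exponential moment. -/
def LukacsOneDim : Prop :=
  ∀ (m : Measure ℝ), IsFiniteMeasure m → ∀ φ : ℝ → ℝ, (∀ s : ℝ, φ s = ∫ q, Real.cos (s * q) ∂m) → AnalyticAt ℝ φ 0 →
    ∃ δ : ℝ, 0 < δ ∧ Integrable (fun q : ℝ => Real.exp (δ * |q|)) m

/-- **Rung R-S1ℓ PROVED**: `LukacsOneDim` holds. -/
theorem lukacsOneDim_holds : LukacsOneDim :=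
  fun m _ φ hφ hA => exists_expMoment_of_analyticAt_cosTransform m φ hφ hA

end Summit.QuantumFields.YangMills.Theorems.F4SubCurvatureDoorForwardConeLukacs

end
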